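import Summits.KontsevichZagierPeriods.KontsevichZagierPeriods.Theorems.SoloBlindSecondGreen
import Summits.KontsevichZagierPeriods.KontsevichZagierPeriods.Theorems.SoloBlindSecondReg
import HarnessLib

/-!
# The Beta relation of the second kind inside the rules

For rationals `a, b ∈ (0,1)` with `1 < a + b` and `s = 2 - a - b ∈ (0,1)`:

  `(1-b) sin(πa) • [β(a, s)] = (1-a) sin(πb) • [β(b, s)]`  in  `Q = 𝓟_formal ⊗ K₀`,

by the Kontsevich–Zagier rules (1)–(3) alone.  Numerically both sides are
`-Γ(a)Γ(b)Γ(s) sin(πa) sin(πb) (a+b-1)/π`, but `a + b > 1`, so — unlike the cyclic relation of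
`SoloBlindCyclicBeta`, which needs `a + b < 1` — no convergent Beta integral on a half-line carries
the identity: the move is Green's formula for the CORRECTED form
`z^{a-1}(1-z)^{b-1} - λ z^{a+b-2} - μ (1-z)^{a+b-2}` (`SoloBlindSecondGreen`), whose edge value on
`(-∞, 0)` pulls back under `x = -v/(1-v)` to the regularised integrand
`R(v) = (v^{a-1} - v^{a+b-2})(1-v)^{-a-b}`, and ONE Newton–Leibniz move
`(a+b-1) ∫₀¹ R = (b-1) B(a, s)` (`SoloBlindSecondReg`).  At level `5` this gives the two
relations missing from the first kind: `3 β(4/5,4/5) ∝ β(2/5,4/5)` and `β(3/5,3/5) ∝ β(3/5,4/5)`.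

References: Kontsevich–Zagier, *Periods* (2001), §1.2; Whittaker–Watson, §12.43.
-/

noncomputable section

open Set Complex MeasureTheory
open Literature.ModelTheory.ExponentialFields MvPolynomial
open Literature.NumberTheory.Transcendental
open Literature.NumberTheory.Transcendental.KZ
open Literature.Analysis.SpecialFunctions.Selberg

namespace Summit.KontsevichZagierPeriods.KontsevichZagierPeriods.Theorems

namespace SoloBlind

namespace SecData

variable (d : SecData)

/-! ## Rational bookkeeping -/

/-- `q₁ = a + b - 1 = σ + 1`. -/
def q₁ : ℚ := (d.k : ℚ) / d.N + (d.l : ℚ) / d.N - 1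

/-- `q₂ = 1 - b = -β`. -/
def q₂ : ℚ := 1 - (d.l : ℚ) / d.N

/-- `s = 2 - a - b = -σ`. -/
def s : ℚ := 2 - (d.k : ℚ) / d.N - (d.l : ℚ) / d.N

/-- `(q₁ : ℝ) = α + β + 1`. -/
theorem q₁_cast : ((d.q₁ : ℚ) : ℝ) = cycExp d.N d.k + cycExp d.N d.l + 1 := by
  simp only [q₁, cycExp]; push_cast; ring

/-- `(q₂ : ℝ) = -β`. -/
theorem q₂_cast : ((d.q₂ : ℚ) : ℝ) = -cycExp d.N d.l := by
  simp only [q₂, cycExp]; push_cast; ring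

/-- `(k/N : ℝ) - 1 = α`. -/
theorem a_cast : ((((d.k : ℚ) / d.N : ℚ)) : ℝ) - 1 = cycExp d.N d.k := by
  rw [cycExp]; push_cast; ring

/-- `(s : ℝ) - 1 = -α - β - 1`. -/
theorem s_cast : ((d.s : ℚ) : ℝ) - 1 = -cycExp d.N d.k - cycExp d.N d.l - 1 := by
  simp only [s, cycExp]; push_cast; ring

/-- `a > 0` and `s > 0`. -/
theorem a_pos_s_pos : 0 < (d.k : ℚ) / d.N ∧ 0 < d.s := by
  have h := d.exp_bounds
  have h1 : (0 : ℝ) < (((d.k : ℚ) / d.N : ℚ) : ℝ) := by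
    have e : ((((d.k : ℚ) / d.N : ℚ)) : ℝ) = cycExp d.N d.k + 1 := by rw [cycExp]; push_cast; ring
    rw [e]; linarith [h.1.1]
  have h2 : (0 : ℝ) < ((d.s : ℚ) : ℝ) := by
    have e : ((d.s : ℚ) : ℝ) = -(cycExp d.N d.k + cycExp d.N d.l) := by
      simp only [s, cycExp]; push_cast; ring
    rw [e]; linarith [h.2.2.2]
  exact ⟨by exact_mod_cast h1, by exact_mod_cast h2⟩

/-- `q₁` is symmetric under `(k,l) ↦ (l,k)`. -/
theorem swap_q₁ : d.swap.q₁ = d.q₁ := by simp only [q₁, swap]; ring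

/-- `s` is symmetric under `(k,l) ↦ (l,k)`. -/
theorem swap_s : d.swap.s = d.s := by simp only [s, swap]; ring

/-! ## The negative half-line representation -/

/-- `N⁻ = [(-∞,0), (-x)^α (1-x)^β - (-x)^σ]`. -/
def negRepK : IntegralRep 1 :=
  lineRep (Iio 0) (fun x => (-x) ^ cycExp d.N d.k * (1 - x) ^ cycExp d.N d.l -
      (-x) ^ (cycExp d.N d.k + cycExp d.N d.l))
    (isSemialgebraic_line_Iio isAlgebraic_zero)
    (((isSemialgebraicFunOn_mellinIntegrand (isSemialgebraic_line_Iio isAlgebraic_zero)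
      ![-X 0, 1 - X 0] ![(d.k : ℚ) / d.N - 1, (d.l : ℚ) / d.N - 1] 1 (fun x hx j => by
        have hx' : x 0 < 0 := hx
        fin_cases j
        · simpa using hx'
        · simp only [Fin.mk_one, Matrix.cons_val_one, Matrix.cons_val_fin_one, map_sub, map_one,
            MvPolynomial.aeval_X, sub_pos]
          linarith)).fun_sub
      (isSemialgebraicFunOn_mellinIntegrand (isSemialgebraic_line_Iio isAlgebraic_zero)
      ![-X 0] ![(d.k : ℚ) / d.N - 1 + ((d.l : ℚ) / d.N - 1)] 1 (fun x hx j => by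
        have hx' : x 0 < 0 := hx
        fin_cases j
        simpa using hx'))).congr fun x _ => by
        beta_reduce
        rw [mellinIntegrand_apply, mellinIntegrand_apply, Fin.prod_univ_two, Fin.prod_univ_one]
        simp only [Matrix.cons_val_zero, Matrix.cons_val_one, Matrix.cons_val_fin_one, map_neg,
          map_sub, map_one, MvPolynomial.aeval_X, Rat.cast_one, one_mul, Rat.cast_add,
          cycExp_cast])
    (integrableOn_negSideK d.exp_bounds.1.1 d.exp_bounds.2.1.1.le d.exp_bounds.2.1.2.le
      d.exp_bounds.2.2.1 d.exp_bounds.2.2.2)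

/-- **`[E⁻] ≡ sin(πa) • N⁻`**: the boundary value
`-Im g(x) = sin(πa) ((-x)^α (1-x)^β - (-x)^σ)` on `x < 0`. -/
theorem edgeNegPart_sub_constMul_negRepK :
    of d.datum.edgeNegPart - of (d.negRepK.constMul (Real.sin (Real.pi * ((d.k : ℝ) / d.N)))
      (isAlgebraic_sinFrac d.N d.k)) ∈ relations := by
  refine of_sub_of_mem_relations_of_eqOn rfl fun x hx => ?_
  have hx' : x 0 < 0 := hx
  simp only [GreenDatum.edgeNegPart, IntegralRep.integrand_restrict, GreenDatum.edgeRep,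
    lineRep_integrand, IntegralRep.integrand_constMul, negRepK]
  rw [GreenDatum.edge_apply, datum_g, im_gK_ofReal_neg d.mu hx' d.hl_rel, sin_pi_mul_cycExp]
  ring

/-! ## The regularised representation on `(0,1)` -/

/-- `R` is `ℚ`-semialgebraic on `(0,1)`. -/
theorem sa_regInt : IsSemialgebraicFunOn ℚ (line (Ioo 0 1))
    fun x => regInt (cycExp d.N d.k) (cycExp d.N d.l) (x 0) := by
  have e1 : ((((d.k : ℚ) / d.N - 1 : ℚ)) : ℝ) = cycExp d.N d.k := cycExp_cast d.N d.k
  have e2 : ((((d.k : ℚ) / d.N - 1 + ((d.l : ℚ) / d.N - 1) : ℚ)) : ℝ) =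
      cycExp d.N d.k + cycExp d.N d.l := by rw [Rat.cast_add, cycExp_cast, cycExp_cast]
  have e3 : (((-((d.k : ℚ) / d.N - 1) - ((d.l : ℚ) / d.N - 1) - 2 : ℚ)) : ℝ) =
      -cycExp d.N d.k - cycExp d.N d.l - 2 := by
    rw [Rat.cast_sub, Rat.cast_sub, Rat.cast_neg, cycExp_cast, cycExp_cast, Rat.cast_ofNat]
  refine ((isSemialgebraicFunOn_const_mul_rpow_mul_rpow 1 ((d.k : ℚ) / d.N - 1)
    (-((d.k : ℚ) / d.N - 1) - ((d.l : ℚ) / d.N - 1) - 2)).fun_sub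
    (isSemialgebraicFunOn_const_mul_rpow_mul_rpow 1 ((d.k : ℚ) / d.N - 1 + ((d.l : ℚ) / d.N - 1))
    (-((d.k : ℚ) / d.N - 1) - ((d.l : ℚ) / d.N - 1) - 2))).congr fun x _ => ?_
  beta_reduce
  rw [e1, e2, e3, regInt, Rat.cast_one, one_mul, one_mul]
  ring

/-- `Reg = [(0,1), R]`. -/
def regRep : IntegralRep 1 :=
  lineRep (Ioo 0 1) (regInt (cycExp d.N d.k) (cycExp d.N d.l))
    (isSemialgebraic_line_Ioo isAlgebraic_zero isAlgebraic_one) d.sa_regInt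
    (integrableOn_regInt d.exp_bounds.1.1 d.exp_bounds.2.1.1.le d.exp_bounds.2.1.2.le
      d.exp_bounds.2.2.1 d.exp_bounds.2.2.2)

/-- **Rule (2) along `x = -v/(1-v)`**: `Reg ≡ N⁻`. -/
theorem regRep_sub_negRepK : of d.regRep - of d.negRepK ∈ relations := by
  refine lineRep_subst (fun v => -moeb v) (fun v => -(1 / (1 - v) ^ 2)) ?_
    (fun v hv => (hasDerivAt_moeb (ne_of_lt hv.2)).neg.hasDerivWithinAt) injOn_negMoeb
    image_negMoeb.symm fun v hv => ?_
  · refine (isSemialgebraicFunOn_aeval_div_aeval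
      (isSemialgebraic_line_Ioo isAlgebraic_zero isAlgebraic_one) (-X 0) (1 - X 0)
      fun x hx => ?_).congr fun x _ => ?_
    · have hx' : 0 < x 0 ∧ x 0 < 1 := hx
      simpa [sub_eq_zero] using (ne_of_lt hx'.2).symm
    · simp [moeb, neg_div]
  · have h1v : 0 < 1 - v := by linarith [hv.2]
    have hJ1 := jacobi_negMoeb₂ (cycExp d.N d.k) (cycExp d.N d.l) hv
    have hJ2 := jacobi_negMoeb₂ (cycExp d.N d.k + cycExp d.N d.l) 0 hv
    rw [Real.rpow_zero, mul_one, show -(cycExp d.N d.k + cycExp d.N d.l) - 0 - 2 =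
      -cycExp d.N d.k - cycExp d.N d.l - 2 by ring] at hJ2
    rw [abs_neg, abs_of_pos (by positivity : (0 : ℝ) < 1 / (1 - v) ^ 2), sub_mul, hJ1, hJ2,
      regInt]
    ring

/-- **`[E⁻(k,l)] = sin(πa) • Reg` in `Q`.** -/
theorem mkQ_edgeNegPart_eq_smul_regRep : mkQ (of d.datum.edgeNegPart) = sinK d.N d.k • mkQ (of d.regRep) := by
  have h : mkQ (of d.datum.edgeNegPart) =
      (⟨Real.sin (Real.pi * ((d.k : ℝ) / d.N)), mem_K₀_iff.mpr (isAlgebraic_sinFrac d.N d.k)⟩ :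
        K₀) • mkQ (of d.regRep) := by
    rw [mkQ_eq_mkQ_iff.mpr d.edgeNegPart_sub_constMul_negRepK, mkQ_constMul,
      mkQ_eq_mkQ_iff.mpr d.regRep_sub_negRepK]
  exact h

/-! ## The Newton–Leibniz move -/

/-- `ρ` is `ℚ`-semialgebraic on `[0,1]`. -/
theorem sa_secRho : IsSemialgebraicFunOn ℚ (line (Icc 0 1))
    fun x => secRho (cycExp d.N d.k) (cycExp d.N d.l) (x 0) := by
  have hb := d.exp_bounds
  have e1 : ((((d.k : ℚ) / d.N : ℚ)) : ℝ) = cycExp d.N d.k + 1 := by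
    rw [cycExp]; push_cast; ring
  have e2 : ((((d.k : ℚ) / d.N + (d.l : ℚ) / d.N - 1 : ℚ)) : ℝ) =
      cycExp d.N d.k + cycExp d.N d.l + 1 := by
    simp only [cycExp]; push_cast; ring
  have e3 : (((1 - (d.k : ℚ) / d.N - (d.l : ℚ) / d.N : ℚ)) : ℝ) =
      -cycExp d.N d.k - cycExp d.N d.l - 1 := by
    simp only [cycExp]; push_cast; ring
  refine isSemialgebraicFunOn_Icc_of_Ioo ?_ 0 0 (fun x hx => ?_) (fun x hx => ?_)
  · refine ((isSemialgebraicFunOn_const_mul_rpow_mul_rpow 1 ((d.k : ℚ) / d.N)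
      (1 - (d.k : ℚ) / d.N - (d.l : ℚ) / d.N)).fun_sub
      (isSemialgebraicFunOn_const_mul_rpow_mul_rpow 1 ((d.k : ℚ) / d.N + (d.l : ℚ) / d.N - 1)
      (1 - (d.k : ℚ) / d.N - (d.l : ℚ) / d.N))).congr fun x _ => ?_
    beta_reduce
    rw [e1, e2, e3, secRho, Rat.cast_one, one_mul, one_mul]
    ring
  · rw [hx, secRho_zero hb.1.1 hb.2.2.1, Rat.cast_zero]
  · rw [hx, secRho_one, Rat.cast_zero]

/-- `ρ'` (extended by `0`) is `ℚ`-semialgebraic on `[0,1]`. -/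
theorem sa_secExact : IsSemialgebraicFunOn ℚ (line (Icc 0 1))
    fun x => secExact (cycExp d.N d.k) (cycExp d.N d.l) (x 0) := by
  have e3 : (((-((d.k : ℚ) / d.N - 1) - ((d.l : ℚ) / d.N - 1) - 1 : ℚ)) : ℝ) =
      -cycExp d.N d.k - cycExp d.N d.l - 1 := by
    rw [Rat.cast_sub, Rat.cast_sub, Rat.cast_neg, cycExp_cast, cycExp_cast, Rat.cast_one]
  refine isSemialgebraicFunOn_Icc_of_Ioo ?_ 0 0 (fun x hx => ?_) (fun x hx => ?_)
  · refine (((isSemialgebraicFunOn_const_of_isAlgebraic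
      (isSemialgebraic_line_Ioo isAlgebraic_zero isAlgebraic_one)
      (isAlgebraic_rat ℚ d.q₁)).fun_mul d.sa_regInt).fun_sub
      (isSemialgebraicFunOn_const_mul_rpow_mul_rpow ((d.l : ℚ) / d.N - 1) ((d.k : ℚ) / d.N - 1)
        (-((d.k : ℚ) / d.N - 1) - ((d.l : ℚ) / d.N - 1) - 1))).congr fun x hx => ?_
    have hx' : x 0 ∈ Ioo (0 : ℝ) 1 := hx
    beta_reduce
    rw [secExact_of_mem hx', q₁_cast, cycExp_cast, cycExp_cast, e3]
  · have h0 : x 0 ∉ Ioo (0 : ℝ) 1 := fun h => by rw [hx] at h; exact lt_irrefl _ h.1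
    rw [secExact, if_neg h0, Rat.cast_zero]
  · have h0 : x 0 ∉ Ioo (0 : ℝ) 1 := fun h => by rw [hx] at h; exact lt_irrefl _ h.2
    rw [secExact, if_neg h0, Rat.cast_zero]

/-- `X = [[0,1], ρ']`. -/
def exactRep : IntegralRep 1 :=
  lineRep (Icc 0 1) (secExact (cycExp d.N d.k) (cycExp d.N d.l))
    (isSemialgebraic_line_Icc isAlgebraic_zero isAlgebraic_one) d.sa_secExact
    (integrableOn_secExact d.exp_bounds.1.1 d.exp_bounds.2.1.1.le d.exp_bounds.2.1.2.le
      d.exp_bounds.2.2.1 d.exp_bounds.2.2.2)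

/-- **Rule (3)**: `[[0,1], ρ'] ∈ relations`, since `ρ(1) - ρ(0) = 0`. -/
theorem exactRep_mem : of d.exactRep ∈ relations := by
  have hb := d.exp_bounds
  have h0 : secRho (cycExp d.N d.k) (cycExp d.N d.l) 1 -
      secRho (cycExp d.N d.k) (cycExp d.N d.l) 0 = 0 := by
    rw [secRho_one, secRho_zero hb.1.1 hb.2.2.1, sub_zero]
  have h : of d.exactRep - of (constCell (secRho (cycExp d.N d.k) (cycExp d.N d.l) 1 -
      secRho (cycExp d.N d.k) (cycExp d.N d.l) 0) (by rw [h0]; exact isAlgebraic_zero)) ∈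
      relations :=
    lineRep_newtonLeibniz isAlgebraic_zero isAlgebraic_one zero_le_one
      (secRho (cycExp d.N d.k) (cycExp d.N d.l)) d.sa_secRho
      (continuousOn_secRho hb.1.1 hb.2.1.1.le hb.2.1.2.le hb.2.2.1 hb.2.2.2)
      fun t ht => by rw [secExact_of_mem ht]; exact hasDerivAt_secRho _ _ ht
  have hc : of (constCell (secRho (cycExp d.N d.k) (cycExp d.N d.l) 1 -
      secRho (cycExp d.N d.k) (cycExp d.N d.l) 0) (by rw [h0]; exact isAlgebraic_zero)) ∈
      relations := by
    rw [constCell_congr h0 (hβ := isAlgebraic_zero)]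
    exact constCell_zero
  simpa using relations.add_mem h hc

/-- `X⁰ = [(0,1), ρ']`, the open restriction. -/
def exactRepO : IntegralRep 1 :=
  d.exactRep.restrict (line (Ioo 0 1)) (isSemialgebraic_line_Ioo isAlgebraic_zero isAlgebraic_one)
    fun _ hx => Ioo_subset_Icc_self hx

/-- `[(0,1), ρ'] ∈ relations`. -/
theorem exactRepO_mem : of d.exactRepO ∈ relations := by
  have h1 : of d.exactRep - of d.exactRepO ∈ relations := by
    refine IntegralRep.of_sub_of_restrict_mem_relations _ _ _ ?_
    show volume (line (Icc (0 : ℝ) 1) \ line (Ioo 0 1)) = 0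
    rw [← show line (Icc (0 : ℝ) 1 \ Ioo 0 1) = line (Icc (0 : ℝ) 1) \ line (Ioo 0 1) from rfl,
      volume_line, Icc_sdiff_Ioo_same zero_le_one]
    exact (toFinite _).measure_zero _
  have h := relations.sub_mem d.exactRep_mem h1
  rwa [sub_sub_cancel] at h

/-- **Rule (1b)**: `[(0,1), ρ'] ≡ q₁ • Reg + q₂ • β(a, s)`. -/
theorem exactRepO_sub_sub :
    of d.exactRepO - of (d.regRep.constMul (d.q₁ : ℝ) (isAlgebraic_rat ℚ d.q₁)) -
      of ((betaRep ((d.k : ℚ) / d.N) d.s d.a_pos_s_pos.1 d.a_pos_s_pos.2).constMul (d.q₂ : ℝ)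
        (isAlgebraic_rat ℚ d.q₂)) ∈ relations := by
  refine integrandAddRel_subset_relations ⟨1, d.exactRepO,
    d.regRep.constMul (d.q₁ : ℝ) (isAlgebraic_rat ℚ d.q₁),
    (betaRep ((d.k : ℚ) / d.N) d.s d.a_pos_s_pos.1 d.a_pos_s_pos.2).constMul (d.q₂ : ℝ) (isAlgebraic_rat ℚ d.q₂),
    rfl, rfl, fun x hx => ?_, rfl⟩
  have hx' : x 0 ∈ Ioo (0 : ℝ) 1 := hx
  simp only [exactRepO, IntegralRep.integrand_restrict, exactRep, lineRep_integrand,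
    Pi.add_apply, IntegralRep.integrand_constMul, regRep, betaRep_integrand]
  rw [secExact_of_mem hx', q₁_cast, q₂_cast, a_cast, s_cast]
  ring

/-- **`q₁ • Reg + q₂ • β(a, s) = 0` in `Q`**, i.e. `(a+b-1) Reg = (b-1) β(a, 2-a-b)`. -/
theorem q₁_smul_regRep :
    (d.q₁ : K₀) • mkQ (of d.regRep) + (d.q₂ : K₀) • betaQ ((d.k : ℚ) / d.N) d.s = 0 := by
  have h := relations.sub_mem d.exactRepO_sub_sub d.exactRepO_mem
  have h' : of (d.regRep.constMul (d.q₁ : ℝ) (isAlgebraic_rat ℚ d.q₁)) +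
      of ((betaRep ((d.k : ℚ) / d.N) d.s d.a_pos_s_pos.1 d.a_pos_s_pos.2).constMul (d.q₂ : ℝ)
        (isAlgebraic_rat ℚ d.q₂)) ∈ relations := by
    have e : of d.exactRepO - of (d.regRep.constMul (d.q₁ : ℝ) (isAlgebraic_rat ℚ d.q₁)) -
        of ((betaRep ((d.k : ℚ) / d.N) d.s d.a_pos_s_pos.1 d.a_pos_s_pos.2).constMul (d.q₂ : ℝ)
          (isAlgebraic_rat ℚ d.q₂)) - of d.exactRepO =
        -(of (d.regRep.constMul (d.q₁ : ℝ) (isAlgebraic_rat ℚ d.q₁)) +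
          of ((betaRep ((d.k : ℚ) / d.N) d.s d.a_pos_s_pos.1 d.a_pos_s_pos.2).constMul (d.q₂ : ℝ)
            (isAlgebraic_rat ℚ d.q₂))) := by abel
    rw [e] at h
    simpa using relations.neg_mem h
  have h2 := mkQ_eq_zero_iff.mpr h'
  rwa [map_add, mkQ_constMul_ratCast, mkQ_constMul_ratCast, ← betaQ_eq d.a_pos_s_pos.1 d.a_pos_s_pos.2] at h2

/-! ## The headline relation -/

/-- **The second-kind Beta relation inside the rules** (level-`N` form): for `k, l < N < k + l`,
`a = k/N`, `b = l/N`, `s = 2 - a - b`,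

  `(1-b) sin(πa) • [β(a, s)] = (1-a) sin(πb) • [β(b, s)]`  in `Q`. -/
theorem betaQ_second :
    (d.q₂ : K₀) • sinK d.N d.k • betaQ ((d.k : ℚ) / d.N) d.s =
      (d.swap.q₂ : K₀) • sinK d.N d.l • betaQ ((d.l : ℚ) / d.N) d.s := by
  have h1 := d.q₁_smul_regRep
  have h2 : (d.q₁ : K₀) • mkQ (of d.swap.regRep) +
      (d.swap.q₂ : K₀) • betaQ ((d.l : ℚ) / d.N) d.s = 0 := by
    have h := d.swap.q₁_smul_regRep
    rwa [swap_q₁, swap_s] at h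
  have h3 : sinK d.N d.k • mkQ (of d.regRep) = sinK d.N d.l • mkQ (of d.swap.regRep) := by
    rw [← d.mkQ_edgeNegPart_eq_smul_regRep, d.mkQ_edgeNegPart_swap]
    exact d.swap.mkQ_edgeNegPart_eq_smul_regRep
  have e1 : (d.q₁ : K₀) • mkQ (of d.regRep) = -((d.q₂ : K₀) • betaQ ((d.k : ℚ) / d.N) d.s) :=
    eq_neg_of_add_eq_zero_left h1
  have e2 : (d.q₁ : K₀) • mkQ (of d.swap.regRep) =
      -((d.swap.q₂ : K₀) • betaQ ((d.l : ℚ) / d.N) d.s) :=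
    eq_neg_of_add_eq_zero_left h2
  have h4 : sinK d.N d.k • ((d.q₁ : K₀) • mkQ (of d.regRep)) =
      sinK d.N d.l • ((d.q₁ : K₀) • mkQ (of d.swap.regRep)) := by
    rw [smul_comm (sinK d.N d.k), smul_comm (sinK d.N d.l), h3]
  rw [e1, e2, smul_neg, smul_neg, neg_inj, smul_comm (sinK d.N d.k), smul_comm (sinK d.N d.l)]
    at h4
  exact h4

end SecData

/-! ## Rational form -/

/-- Two rationals `a, b < 1` with `1 < a + b` are `k/N`, `l/N` for second-kind data. -/
theorem exists_secData (a b : ℚ) (ha : a < 1) (hb : b < 1) (hab : 1 < a + b) :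
    ∃ d : SecData, (d.k : ℚ) / d.N = a ∧ (d.l : ℚ) / d.N = b := by
  have ha0 : 0 < a := by linarith
  have hb0 : 0 < b := by linarith
  have hda : (0 : ℚ) < a.den := by exact_mod_cast a.den_pos
  have hdb : (0 : ℚ) < b.den := by exact_mod_cast b.den_pos
  have hna : 0 < a.num := Rat.num_pos.mpr ha0
  have hnb : 0 < b.num := Rat.num_pos.mpr hb0
  have hk : ((a.num.toNat * b.den : ℕ) : ℚ) = a * (a.den * b.den) := by
    have h : ((a.num.toNat : ℕ) : ℚ) = (a.num : ℚ) := by exact_mod_cast Int.toNat_of_nonneg hna.le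
    push_cast
    rw [h, ← mul_assoc, Rat.mul_den_eq_num]
  have hl : ((b.num.toNat * a.den : ℕ) : ℚ) = b * (a.den * b.den) := by
    have h : ((b.num.toNat : ℕ) : ℚ) = (b.num : ℚ) := by exact_mod_cast Int.toNat_of_nonneg hnb.le
    push_cast
    rw [h, mul_comm (a.den : ℚ), ← mul_assoc, Rat.mul_den_eq_num]
  have hN' : (0 : ℚ) < a.den * b.den := by positivity
  have hkN : a.num.toNat * b.den < a.den * b.den := by
    have h : ((a.num.toNat * b.den : ℕ) : ℚ) < ((a.den * b.den : ℕ) : ℚ) := by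
      rw [hk]; push_cast; nlinarith
    exact_mod_cast h
  have hlN : b.num.toNat * a.den < a.den * b.den := by
    have h : ((b.num.toNat * a.den : ℕ) : ℚ) < ((a.den * b.den : ℕ) : ℚ) := by
      rw [hl]; push_cast; nlinarith
    exact_mod_cast h
  have hsum : a.den * b.den < a.num.toNat * b.den + b.num.toNat * a.den := by
    have h : ((a.den * b.den : ℕ) : ℚ) <
        ((a.num.toNat * b.den : ℕ) : ℚ) + ((b.num.toNat * a.den : ℕ) : ℚ) := by
      rw [hk, hl, ← add_mul]; push_cast; nlinarith
    exact_mod_cast h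
  refine ⟨⟨a.den * b.den, a.num.toNat * b.den, b.num.toNat * a.den, hkN, hlN, hsum⟩, ?_, ?_⟩
  · show ((a.num.toNat * b.den : ℕ) : ℚ) / ((a.den * b.den : ℕ) : ℚ) = a
    rw [hk, Nat.cast_mul, mul_div_assoc, div_self (by positivity), mul_one]
  · show ((b.num.toNat * a.den : ℕ) : ℚ) / ((a.den * b.den : ℕ) : ℚ) = b
    rw [hl, Nat.cast_mul, mul_div_assoc, div_self (by positivity), mul_one]

/-- **The second-kind Beta relation inside the rules**: for rationals `a, b < 1` with
`1 < a + b`,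

  `(1-b) sin(πa) • [β(a, 2-a-b)] = (1-a) sin(πb) • [β(b, 2-a-b)]`  in  `Q`.

Together with the first kind (`betaQ_cyclic_rat`, `a + b < 1`) and the translations
`(a+b) β(a,b+1) = b β(a,b)`, this relates the Beta classes of an `S₃`-orbit in BOTH regimes of
the reflection `c = 1 - a - b ↔ s = 2 - a - b`. -/
theorem betaQ_second_rat (a b : ℚ) (ha : a < 1) (hb : b < 1) (hab : 1 < a + b) :
    ((1 - b : ℚ) : K₀) • sinQ a • betaQ a (2 - a - b) =
      ((1 - a : ℚ) : K₀) • sinQ b • betaQ b (2 - a - b) := by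
  obtain ⟨d, hk, hl⟩ := exists_secData a b ha hb hab
  have h := d.betaQ_second
  simp only [SecData.q₂, SecData.s, SecData.swap, sinK_eq_sinQ, hk, hl] at h
  exact h

end SoloBlind

end Summit.KontsevichZagierPeriods.KontsevichZagierPeriods.Theorems
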